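import Summits.BirchSwinnertonDyer.BirchSwinnertonDyer.Theses.EisensteinPrimes
import Summits.BirchSwinnertonDyer.Rank1Residual.X1.GoodLatticeExists
import Summits.BirchSwinnertonDyer.Rank1Residual.Partition.EisensteinKernelReductionLine
import Literature.Barriers.BirchSwinnertonDyer.EisensteinMuConjecture
import Literature.NumberTheory.EllipticCurves.TateCurve.NumberFieldUniformization
import Literature.NumberTheory.EllipticCurves.TateCurve.NumberFieldUniformizationTwisted
import HarnessLib

/-!
# Crux `MazurMCOnX1RankZero` (stmt-BirchSwinnertonDyer-19035), line `mudescent`, stub `stub_locate`: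
# every rank-`0` X1 pair is `ℚ`-isogenous to one OFF the `μ`-barrier locus (the «étale end» of the
# `p`-isogeny graph: all rational `p`-lines unramified)

Cell `bsd-eis` (FULL-BSD rank-≤1 programme D-0033, HOME `run/shared/lean/pub/bsd-eis/`), seat
`bsd-eis-ky` gen 7, line `mudescent` = the Λ-adic isogeny μ-descent registered on cruxes 3 and 5 of
route `EisensteinPrimes` (rung K5; judge J ask (γ)). This file LANDS the line's DESCEND stub on crux 5
(row A3 = X1 ∩ {r_an = 0}) by the mirror image of the tree's KERNEL theorem
`X1.GoodLatticeExists.exists_isIsogenous_noUnramifiedLine` (Keller–Yin's good lattice = the member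
with NO unramified rational `p`-line = the `μ`-MAXIMAL end, `11a2` at `5`), «unramified» ↔ «ramified»:
* §1 `lineUnramifiedAt_range_of_ker_ramified` — Galois modules: for an equivariant `g : E[p] → E'[p]`
  whose kernel is a line RAMIFIED at `p`, the image `g(E[p])` is a rational line UNRAMIFIED at `p`,
  granted (hL₀) at ONE prime `𝔓 ∣ p` a line `L ≤ E[p]` with `(σ − 1)E[p] ⊆ L` for `σ ∈ I_𝔓` and a point
  of `L` moved by `I_𝔓` (reduction line at an ordinary `p`, Tate line at a multiplicative `p`): the
  kernel is moved by `I_𝔓` (one-prime criterion `KernelDisc.lineUnramifiedAt_iff_forall_mem_inertia`),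
  so it meets `L` non-trivially, `ker g = L`, and `σ·g(P) − g(P) = g(σP − P) ∈ g(L) = 0`.
* §2 `exists_isIsogenous_forall_lineUnramifiedAt_of_localLine` — with (hL₀): a globally minimal `E` is
  `ℚ`-isogenous to a globally minimal `E₀` ALL of whose rational `p`-lines are unramified. If `E` has a
  ramified rational line `Φ`: quotient by a MAXIMAL `Γ_ℚ`-stable cyclic `ℤx` with `(ℤx)[p] = Φ`
  (`X1.StableCyclicQuotient.bddAbove_setOf_stableCyclic`: Shafarevich `finite_isogenyClass_holds` +
  `End_ℚ(E) = ℤ`); a ramified line `ℤq₀` of `E₀ = E/ℤx` lifts to `y` with `py = ax`; `p ∤ a` ⇒ `ℤy ⊋ ℤx`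
  stable cyclic of order `p^{k+1}` through `Φ` (maximality); `p ∣ a` ⇒ the line is the image of `E[p]`
  modulo `Φ`, unramified by §1 — contradiction.
* §3 at a good ORDINARY odd `p` ((hL₀) = `X2.IsogenyLineTypeGoodOrdinary.exists_reductionLine_adicCompletionPrime`)
  and at an odd MULTIPLICATIVE `p` ((hL₀) = `X2.IsogenyLineType.exists_tateLine_adicCompletionPrime`,
  Tate uniformisation A40/A41 DISCHARGED); off the barrier locus `HasRamifiedOddLineAt`.
* §4 **`stub_locate`** — EXACTLY the signature registered on stmt-…-19035 (the rank hypothesis is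
  idle; a good Eisenstein `p > 2` is ordinary, `Rank1Residual.goodOrd_of_red_of_good`).

WHY: the line's DESCEND step — Greenberg LNM 1716 Conj. 1.11 «there exists a ℚ-isogenous elliptic
curve E′ such that μ_{E′} = 0», Prop. 5.7 (a ramified-odd line forces `μ ≥ 1`), §5 (`X₀(11)/μ_5 =
X₁(11) = 11a3` at `5`: all `5`-lines unramified, `μ = 0`); Stevens 1989 Rem. 4.14 (`A_min`). HONEST
FRAMING: an unconditional kernel theorem (inputs: tree theorems — `_holds` discharges of *AEC*
III.4.12, VIII.8.3, IX.6.2, V.5.3–5.4, the reduction line, `End_ℚ(E) = ℤ`); it proves NOTHING about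
`μ`; the constructions `stub_analyticMuZero_offLocus` / `stub_lambdaCount_offLocus` remain OPEN. No
definition, no named fact. References: [GreenbergLNM1716] Conj. 1.11, Prop. 5.7, §5; [Stevens1989]
Cor. 4.13, Rem. 4.14; [SilvermanAEC2009] III.4.12, IX.6.2; [SilvermanATAEC1994] V.5.3–5.4;
[GreenbergVatsal2000] §2 p. 28; HOME/ky-g7/Lines-mudescent-MazurMCOnX1RankZero.lean.
-/


set_option autoImplicit false

noncomputable section

open scoped Classical

open WeierstrassCurve NumberField IsDedekindDomain Literature.NumberTheory.EllipticCurves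
  Literature.NumberTheory.EllipticCurves.Rank1Residual
  Literature.NumberTheory.GaloisRepresentations Field
  Literature.Barriers.BirchSwinnertonDyer
  Summit.BirchSwinnertonDyer.Rank1Residual
  Summit.BirchSwinnertonDyer.Rank1Residual.X2.IsogenyLineType
  Summit.BirchSwinnertonDyer.Rank1Residual.X2.IsogenyLineTypeGoodOrdinary
  Summit.BirchSwinnertonDyer.Rank1Residual.X1.StableCyclicQuotient

-- `Summit.BirchSwinnertonDyer.BirchSwinnertonDyer.…`: the summit and its single sub-problem share a name (D-0017 layout).
set_option linter.dupNamespace false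

namespace Summit.BirchSwinnertonDyer.BirchSwinnertonDyer.Theorems.EisensteinPrimesMazurMCOnX1RankZeroLocate

variable {p : ℕ} [hp : Fact p.Prime]

/-! ## §1 The image of `E[p]` modulo a RAMIFIED line is an UNRAMIFIED rational line -/

section Galois

variable {W W' : WeierstrassCurve ℚ}

/-- **Mirror of `X1.StableCyclicQuotient.isRationalLine_range_and_not_unramified_of_ker`.** For
`g : E[p] → E'[p]` `Γ_ℚ`-equivariant with kernel of order `p` RAMIFIED at `p`, `#E[p] = p²`, and (hL₀)
at one `𝔓 ∣ p`: `g(E[p])` is a rational line of `E'` UNRAMIFIED at `p` (the kernel is moved by `I_𝔓`,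
so it equals `L`; then `τ·g(Q) − g(Q) = g(τQ − Q) ∈ g(L) = 0`; one-prime criterion
`KernelDisc.lineUnramifiedAt_iff_forall_mem_inertia` on both sides). GV p. 28 with `φ`, `ψ` exchanged.
[cite: GreenbergVatsal2000, §2 p. 28] -/
theorem lineUnramifiedAt_range_of_ker_ramified
    (g : geomTorsion W (p : ℤ) →+ geomTorsion W' (p : ℤ))
    (hg : ∀ (σ : absoluteGaloisGroup ℚ) (P : geomTorsion W (p : ℤ)), g (σ • P) = σ • g P)
    (hE : Nat.card (geomTorsion W (p : ℤ)) = p ^ 2)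
    (hL₀ : ∃ (v : HeightOneSpectrum (𝓞 ℚ)), (p : 𝓞 ℚ) ∈ v.asIdeal ∧ ∃ 𝔓 ∈ v.primesAbove,
      ∃ L : AddSubgroup (geomTorsion W (p : ℤ)), Nat.card L = p ∧
        (∀ σ ∈ 𝔓.inertia (absoluteGaloisGroup ℚ), ∀ P : geomTorsion W (p : ℤ), σ • P - P ∈ L) ∧
        (∃ σ ∈ 𝔓.inertia (absoluteGaloisGroup ℚ), ∃ P ∈ L, σ • P ≠ P))
    (hK : Nat.card g.ker = p) (hram : ¬ LineUnramifiedAt W p g.ker) :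
    IsRationalLine W' p g.range ∧ LineUnramifiedAt W' p g.range := by
  have hrat : IsRationalLine W' p g.range := isRationalLine_range g hg hE hK
  refine ⟨hrat, ?_⟩
  obtain ⟨v, hv, 𝔓, h𝔓, L, hLcard, hLsub, -⟩ := hL₀
  -- `ker g` is a rational line (stable under `Γ_ℚ` by equivariance)
  have hKrat : IsRationalLine W p g.ker := by
    refine ⟨hK, fun σ P hP ↦ ?_⟩
    rw [AddMonoidHom.mem_ker] at hP ⊢
    rw [hg, hP, smul_zero]
  -- `ker g` is moved by `I_𝔓` (else it would be unramified, by the one-prime criterion)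
  have hmov : ∃ σ ∈ 𝔓.inertia (absoluteGaloisGroup ℚ), ∃ P ∈ g.ker, σ • P ≠ P := by
    by_contra h
    push Not at h
    exact hram ((KernelDisc.lineUnramifiedAt_iff_forall_mem_inertia hKrat hv h𝔓).mpr h)
  obtain ⟨σ, hσ, P, hPK, hσP⟩ := hmov
  -- hence `ker g = L`
  have hd : σ • P - P ∈ L := hLsub σ hσ P
  have hdK : σ • P - P ∈ g.ker := g.ker.sub_mem (hKrat.2 σ P hPK) hPK
  have hKL : g.ker = L := eq_of_prime_card_of_mem hK hLcard (sub_ne_zero.mpr hσP) hdK hd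
  -- so `I_𝔓` fixes `g(E[p])` pointwise; unramified by the one-prime criterion
  refine (KernelDisc.lineUnramifiedAt_iff_forall_mem_inertia hrat hv h𝔓).mpr ?_
  rintro τ hτ Q ⟨R, rfl⟩
  have h1 : τ • R - R ∈ g.ker := by rw [hKL]; exact hLsub τ hτ R
  rw [AddMonoidHom.mem_ker, map_sub, hg] at h1
  exact sub_eq_zero.mp h1

end Galois

/-! ## §2 The étale end: the quotient by a MAXIMAL stable cyclic subgroup through a ramified line -/

section Main

variable {V : WeierstrassCurve ℚ} [V.IsElliptic] [V.IsGloballyMinimal]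

omit [V.IsElliptic] [V.IsGloballyMinimal] in
/-- `ℤ·x` is finite and `Γ_ℚ`-stable (verbatim the private helper of `X1.GoodLatticeExists`). [folklore] -/
private theorem zmultiples_finite_stable {x : V.geomPoints} {n : ℕ} (hn : n ≠ 0)
    (hord : addOrderOf x = n) (hstab : ∀ σ : absoluteGaloisGroup ℚ, σ • x ∈ AddSubgroup.zmultiples x) :
    (AddSubgroup.zmultiples x : Set V.geomPoints).Finite ∧
      ∀ (σ : absoluteGaloisGroup ℚ) (P : V.geomPoints), P ∈ AddSubgroup.zmultiples x →
        σ • P ∈ AddSubgroup.zmultiples x := by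
  refine ⟨?_, fun σ P hP ↦ ?_⟩
  · have : Finite (AddSubgroup.zmultiples x) := by
      apply Nat.finite_of_card_ne_zero; rw [Nat.card_zmultiples, hord]; exact hn
    exact Set.toFinite _
  · obtain ⟨m, rfl⟩ := AddSubgroup.mem_zmultiples_iff.mp hP
    rw [smul_comm σ m x]
    exact AddSubgroup.zsmul_mem _ (hstab σ) m

/-- **The étale end of the `p`-isogeny graph exists.** For `E/ℚ` globally minimal and a prime `p` at which
(hL₀) holds (a line `L ≤ E[p]` at one `𝔓 ∣ p` with `(σ − 1)E[p] ⊆ L` for `σ ∈ I_𝔓` and a point of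
`L` moved by `I_𝔓` — the reduction line at an ordinary `p`, the Tate line at a multiplicative `p`),
there is a globally minimal elliptic `E₀` with `IsIsogenous E E₀` ALL of whose rational `p`-lines are
UNRAMIFIED at `p` (`E₀ = E` if `E` has no ramified rational line, else `E₀ = E/ℤx` for a MAXIMAL stable
cyclic `ℤx` through a ramified line; module docstring §2). The mirror image of
`X1.GoodLatticeExists.exists_isIsogenous_noUnramifiedLine` (LNM 1716 §5: `X₀(11)/μ_5 = X₁(11)`).
[cite: GreenbergLNM1716, Conj. 1.11 (p. 58) and §5] [cite: SilvermanAEC2009, Prop. III.4.12, Cor. IX.6.2] -/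
theorem exists_isIsogenous_forall_lineUnramifiedAt_of_localLine
    (hL₀ : ∃ (v : HeightOneSpectrum (𝓞 ℚ)), (p : 𝓞 ℚ) ∈ v.asIdeal ∧ ∃ 𝔓 ∈ v.primesAbove,
      ∃ L : AddSubgroup (geomTorsion V (p : ℤ)), Nat.card L = p ∧
        (∀ σ ∈ 𝔓.inertia (absoluteGaloisGroup ℚ), ∀ P : geomTorsion V (p : ℤ), σ • P - P ∈ L) ∧
        (∃ σ ∈ 𝔓.inertia (absoluteGaloisGroup ℚ), ∃ P ∈ L, σ • P ≠ P)) :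
    ∃ (W : WeierstrassCurve ℚ) (_ : W.IsElliptic) (_ : W.IsGloballyMinimal),
      IsIsogenous V W ∧
        ∀ Φ : AddSubgroup (geomTorsion W (p : ℤ)), IsRationalLine W p Φ → LineUnramifiedAt W p Φ := by
  have hp' : p.Prime := hp.out
  have hpz : Prime (p : ℤ) := Int.prime_iff_natAbs_prime.mpr (by simpa using hp')
  by_cases hex : ∃ Φ : AddSubgroup (geomTorsion V (p : ℤ)), IsRationalLine V p Φ ∧ ¬ LineUnramifiedAt V p Φ
  swap
  · push Not at hex
    exact ⟨V, inferInstance, inferInstance, IsIsogenous.refl_holds V, hex⟩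
  obtain ⟨Φ, hΦ, hu⟩ := hex
  -- the line `Φ' = Φ ⊂ E(ℚ̄)` and a generator
  set Φ' : AddSubgroup V.geomPoints := Φ.map (geomTorsion V (p : ℤ)).subtype with hΦ'
  have hΦ'card : Nat.card Φ' = p := X2.IsogenyQuotientLine.natCard_map_subtype hΦ
  obtain ⟨x₀, hx₀Φ, hx₀0, hx₀ord, hx₀gen⟩ := exists_generator_of_prime_card (p := p) Φ' hΦ'card
  -- the set of good orders is non-empty (k = 1) and bounded; take the maximum
  let T : Set ℕ := {k : ℕ | ∃ x : V.geomPoints, addOrderOf x = p ^ k ∧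
    (∀ σ : absoluteGaloisGroup ℚ, σ • x ∈ AddSubgroup.zmultiples x) ∧
      p ^ (k - 1) • x ∈ Φ' ∧ p ^ (k - 1) • x ≠ 0}
  have h1T : 1 ∈ T := by
    refine ⟨x₀, by rw [pow_one]; exact hx₀ord, fun σ ↦ ?_,
      by rw [Nat.sub_self, pow_zero, one_smul]; exact hx₀Φ, by rw [Nat.sub_self, pow_zero, one_smul]; exact hx₀0⟩
    rw [hx₀gen]
    obtain ⟨P, hP, rfl⟩ := hx₀Φ
    exact ⟨σ • P, hΦ.2 σ P hP, rfl⟩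
  have hbdd : BddAbove T := by
    refine BddAbove.mono (fun k hk ↦ ?_) (bddAbove_setOf_stableCyclic (V := V) (p := p))
    obtain ⟨x, h1, h2, -⟩ := hk
    exact ⟨x, h1, h2⟩
  obtain ⟨x, hxord, hxstab, hxΦ, hx0⟩ : sSup T ∈ T := Nat.sSup_mem ⟨1, h1T⟩ hbdd
  set k := sSup T with hk
  have hk1 : 1 ≤ k := le_csSup hbdd h1T
  -- `t = p^{k-1} x` generates `Φ'`, of order `p`
  set t : V.geomPoints := p ^ (k - 1) • x with ht
  have htgen : AddSubgroup.zmultiples t = Φ' :=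
    eq_of_prime_card_of_mem (p := p) (H₁ := AddSubgroup.zmultiples t) (H₂ := Φ') (by
      rw [Nat.card_zmultiples]
      haveI : Finite Φ' := Nat.finite_of_card_ne_zero (by rw [hΦ'card]; exact hp'.ne_zero)
      have hdvd : addOrderOf (⟨t, hxΦ⟩ : Φ') ∣ p := by rw [← hΦ'card]; exact addOrderOf_dvd_natCard _
      rw [AddSubgroup.addOrderOf_mk] at hdvd
      rcases (Nat.dvd_prime hp').mp hdvd with h | h
      · exact absurd (AddMonoid.addOrderOf_eq_one_iff.mp h) hx0
      · exact h) hΦ'card hx0 (AddSubgroup.mem_zmultiples t) hxΦ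
  have htord : addOrderOf t = p := by
    have h := congrArg (fun H : AddSubgroup V.geomPoints ↦ Nat.card H) htgen
    simp only [Nat.card_zmultiples] at h
    rw [h, hΦ'card]
  -- the quotient `E₀ = E/ℤx`
  obtain ⟨hfin, hst⟩ := zmultiples_finite_stable (V := V) (pow_ne_zero k hp'.ne_zero) hxord hxstab
  obtain ⟨W, hW, hWmin, g, hker⟩ := exists_minimal_isogeny_ker_eq (AddSubgroup.zmultiples x) hfin hst
  refine ⟨W, hW, hWmin, ⟨g⟩, fun Ψ hΨ ↦ ?_⟩
  by_contra hunΨ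
  -- a generator `q₀` of `Ψ` and a preimage `y`
  obtain ⟨q₀, hq₀Ψ, hq₀0, -, hq₀gen⟩ := exists_generator_of_prime_card (p := p) Ψ hΨ.1
  obtain ⟨y, hy⟩ := g.surjective (q₀ : W.geomPoints)
  -- `p y ∈ ker g = ℤ x`: `a x = p y`
  have hpy : (p : ℤ) • y ∈ g.toAddMonoidHom.ker := by
    rw [AddMonoidHom.mem_ker, map_zsmul, Isogeny.coe_toAddMonoidHom, hy]
    exact (Submodule.mem_torsionBy_iff (p : ℤ) _).mp q₀.2
  rw [hker] at hpy
  obtain ⟨a, ha⟩ := AddSubgroup.mem_zmultiples_iff.mp hpy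
  -- `p^k x = 0`
  have hpkx : ((p : ℤ) ^ k) • x = 0 := by
    rw [← Nat.cast_pow, natCast_zsmul, ← hxord]; exact addOrderOf_nsmul_eq_zero x
  by_cases hdvd : (p : ℤ) ∣ a
  · -- `p ∣ a`: then `E[p] ↠ Ψ` — unramified
    obtain ⟨a', rfl⟩ := hdvd
    set z : V.geomPoints := y - a' • x with hz
    have hpz0 : (p : ℤ) • z = 0 := by
      rw [hz, smul_sub, ← ha, smul_smul]
      exact sub_self _
    have hzmem : z ∈ geomTorsion V (p : ℤ) := (Submodule.mem_torsionBy_iff (p : ℤ) _).mpr hpz0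
    have hxker : x ∈ g.toAddMonoidHom.ker := by rw [hker]; exact AddSubgroup.mem_zmultiples x
    have hgz : g z = (q₀ : W.geomPoints) := by
      rw [hz, map_sub, map_zsmul, hy]
      rw [AddMonoidHom.mem_ker, Isogeny.coe_toAddMonoidHom] at hxker
      rw [hxker, smul_zero, sub_zero]
    -- restrict `g` to `E[p]`; its kernel is `(ℤx)[p] = Φ`
    obtain ⟨g', hg'val, hg'⟩ := exists_restrict_torsion (p := p) g
    have hker' : g'.ker = Φ := by
      ext P
      rw [AddMonoidHom.mem_ker]
      constructor
      · intro hP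
        have h1 : (P : V.geomPoints) ∈ g.toAddMonoidHom.ker := by
          rw [AddMonoidHom.mem_ker, Isogeny.coe_toAddMonoidHom, ← hg'val, hP]; rfl
        rw [hker] at h1
        obtain ⟨m, hm⟩ := AddSubgroup.mem_zmultiples_iff.mp h1
        -- `p^k ∣ p m` since `p (m x) = 0`
        have hP0 : (p : ℤ) • (P : V.geomPoints) = 0 := (Submodule.mem_torsionBy_iff (p : ℤ) _).mp P.2
        have hdiv : (addOrderOf x : ℤ) ∣ p * m := by
          rw [addOrderOf_dvd_iff_zsmul_eq_zero, mul_smul, hm, hP0]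
        rw [hxord, Nat.cast_pow] at hdiv
        obtain ⟨m', hm'⟩ : (p : ℤ) ^ (k - 1) ∣ m := by
          have hk' : k = (k - 1) + 1 := by omega
          have hdiv' : (p : ℤ) ^ (k - 1) * p ∣ m * p := by
            rw [hk', pow_succ, mul_comm (p : ℤ) m] at hdiv; exact hdiv
          have hp0 : (p : ℤ) ≠ 0 := by exact_mod_cast hp'.ne_zero
          exact (mul_dvd_mul_iff_right hp0).mp hdiv'
        -- so `P = m' • t ∈ Φ'`
        have hPt : (P : V.geomPoints) ∈ Φ' := by
          rw [← htgen, AddSubgroup.mem_zmultiples_iff]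
          refine ⟨m', ?_⟩
          rw [ht, ← hm, hm', mul_comm, mul_smul, ← Nat.cast_pow, natCast_zsmul]
        obtain ⟨Q, hQ, hQP⟩ := hPt
        have : Q = P := Subtype.ext hQP
        exact this ▸ hQ
      · intro hP
        have hPt : (P : V.geomPoints) ∈ Φ' := ⟨P, hP, rfl⟩
        rw [← htgen, AddSubgroup.mem_zmultiples_iff] at hPt
        obtain ⟨m, hm⟩ := hPt
        have h1 : (P : V.geomPoints) ∈ g.toAddMonoidHom.ker := by
          rw [hker, AddSubgroup.mem_zmultiples_iff]
          exact ⟨m * (p : ℤ) ^ (k - 1), by rw [mul_smul, ← hm, ht, ← Nat.cast_pow, natCast_zsmul]⟩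
        rw [AddMonoidHom.mem_ker, Isogeny.coe_toAddMonoidHom, ← hg'val] at h1
        exact Subtype.ext h1
    have hK : Nat.card g'.ker = p := by rw [hker']; exact hΦ.1
    obtain ⟨hrat, hunr⟩ := lineUnramifiedAt_range_of_ker_ramified g' hg'
      (Rank1Residual.natCard_geomTorsion V p) hL₀ hK (hker' ▸ hu)
    -- `g'(E[p]) = Ψ`: both are lines containing `q₀ ≠ 0`
    have hq₀range : q₀ ∈ g'.range := by
      refine ⟨⟨z, hzmem⟩, Subtype.ext ?_⟩
      rw [hg'val]; exact hgz
    have hrange : g'.range = Ψ := eq_of_prime_card_of_mem (p := p) hrat.1 hΨ.1 hq₀0 hq₀range hq₀Ψ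
    exact hunΨ (hrange ▸ hunr)
  · -- `p ∤ a`: `ℤy` is a bigger good subgroup; `x ∈ ℤ y` (Bezout: `a` is a unit mod `p^k`)
    have hcop : IsCoprime ((p : ℤ) ^ k) a := (IsCoprime.pow_left ((Prime.coprime_iff_not_dvd hpz).mpr hdvd))
    obtain ⟨u, w, huw⟩ := hcop
    have hxy : x ∈ AddSubgroup.zmultiples y := by
      have : x = w • ((p : ℤ) • y) := by
        calc x = (u * (p : ℤ) ^ k + w * a) • x := by rw [huw, one_smul]
          _ = u • (((p : ℤ) ^ k) • x) + w • (a • x) := by rw [add_smul, mul_smul, mul_smul]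
          _ = w • ((p : ℤ) • y) := by rw [hpkx, smul_zero, zero_add, ha]
      rw [this, smul_smul]
      exact AddSubgroup.zsmul_mem _ (AddSubgroup.mem_zmultiples y) _
    have hpky : p ^ k • y = a • t := by
      have hk' : k = (k - 1) + 1 := by omega
      calc p ^ k • y = ((p : ℤ) ^ (k - 1) * (p : ℤ)) • y := by
              rw [← natCast_zsmul, Nat.cast_pow, ← pow_succ, ← hk']
        _ = ((p : ℤ) ^ (k - 1) * a) • x := by rw [mul_smul ((p : ℤ) ^ (k - 1)) (p : ℤ) y, ← ha, ← mul_smul]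
        _ = a • t := by rw [mul_comm, mul_smul, ht, ← natCast_zsmul x (p ^ (k - 1)), Nat.cast_pow]
    have hat0 : a • t ≠ 0 := by
      intro h0
      apply hdvd
      have := addOrderOf_dvd_iff_zsmul_eq_zero.mpr h0
      rwa [htord] at this
    have hpk1y : p ^ (k + 1) • y = 0 := by
      calc p ^ (k + 1) • y = p • (p ^ k • y) := by rw [pow_succ', mul_smul]
        _ = p • (a • t) := by rw [hpky]
        _ = a • (p • t) := smul_comm _ _ _
        _ = 0 := by rw [← htord, addOrderOf_nsmul_eq_zero, smul_zero]
    have hyord : addOrderOf y = p ^ (k + 1) :=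
      addOrderOf_eq_prime_pow (by rw [hpky]; exact hat0) hpk1y
    -- `ℤ y` is `Γ_ℚ`-stable: `g(σ y) = σ q₀ = m q₀ = g(m y)`
    have hystab : ∀ σ : absoluteGaloisGroup ℚ, σ • y ∈ AddSubgroup.zmultiples y := by
      intro σ
      have hσq : σ • q₀ ∈ AddSubgroup.zmultiples q₀ := by rw [hq₀gen]; exact hΨ.2 σ q₀ hq₀Ψ
      obtain ⟨m, hm⟩ := AddSubgroup.mem_zmultiples_iff.mp hσq
      have hdiff : σ • y - m • y ∈ g.toAddMonoidHom.ker := by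
        rw [AddMonoidHom.mem_ker, map_sub, map_zsmul, Isogeny.coe_toAddMonoidHom, Isogeny.map_smul, hy,
          ← AddSubgroup.torsionBy.coe_smul, ← hm]
        simp
      rw [hker] at hdiff
      have hsub : AddSubgroup.zmultiples x ≤ AddSubgroup.zmultiples y := AddSubgroup.zmultiples_le_of_mem hxy
      have := hsub hdiff
      have h2 : σ • y = (σ • y - m • y) + m • y := by abel
      rw [h2]
      exact AddSubgroup.add_mem _ this (AddSubgroup.zsmul_mem _ (AddSubgroup.mem_zmultiples y) m)
    have hmem : k + 1 ∈ T := by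
      refine ⟨y, hyord, hystab, ?_, ?_⟩
      · rw [Nat.add_sub_cancel, hpky, ← htgen]
        exact AddSubgroup.zsmul_mem _ (AddSubgroup.mem_zmultiples t) a
      · rw [Nat.add_sub_cancel, hpky]; exact hat0
    have : k + 1 ≤ k := hk ▸ le_csSup hbdd hmem
    omega

end Main

/-! ## §3 At a good ordinary / multiplicative odd prime; off the `μ`-barrier locus -/

section Reduction

variable {V : WeierstrassCurve ℚ} [V.IsElliptic] [V.IsGloballyMinimal]

/-- **The étale end exists at a good Eisenstein prime `p > 2`** (ordinary by `goodOrd_of_red_of_good`;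
(hL₀) = the reduction line `C_p[p]`): `E` is `ℚ`-isogenous to a globally minimal `E₀` all of whose
rational `p`-lines are unramified. [cite: GreenbergLNM1716, Conj. 1.11 (p. 58) and §5] [cite: GreenbergVatsal2000, §2 p. 26, p. 28] -/
theorem exists_isIsogenous_forall_lineUnramifiedAt_of_good (hp2 : 2 < p) (hgood : Good V p)
    (hred : Red V p) :
    ∃ (W : WeierstrassCurve ℚ) (_ : W.IsElliptic) (_ : W.IsGloballyMinimal),
      IsIsogenous V W ∧
        ∀ Φ : AddSubgroup (geomTorsion W (p : ℤ)), IsRationalLine W p Φ → LineUnramifiedAt W p Φ := by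
  have hord : GoodOrd V p := Rank1Residual.goodOrd_of_red_of_good V p hp2 hgood hred
  exact exists_isIsogenous_forall_lineUnramifiedAt_of_localLine
    (exists_reductionLine_adicCompletionPrime V p (by omega) hgood hord.2)

/-- **The étale end exists at an odd multiplicative prime** ((hL₀) = the Tate line `C[p] ≅ μ_p`, Tate
uniformisation *ATAEC* V.5.3 / V.5.4 DISCHARGED in the tree): `E` is `ℚ`-isogenous to a globally
minimal `E₀` all of whose rational `p`-lines are unramified. [cite: SilvermanATAEC1994, Thm. V.5.3 and Cor. V.5.4]
[cite: GreenbergLNM1716, Conj. 1.11 (p. 58)] -/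
theorem exists_isIsogenous_forall_lineUnramifiedAt_of_mult (hp2 : p ≠ 2)
    (hmult : V.HasMultiplicativeReductionAtPrime p) :
    ∃ (W : WeierstrassCurve ℚ) (_ : W.IsElliptic) (_ : W.IsGloballyMinimal),
      IsIsogenous V W ∧
        ∀ Φ : AddSubgroup (geomTorsion W (p : ℤ)), IsRationalLine W p Φ → LineUnramifiedAt W p Φ :=
  exists_isIsogenous_forall_lineUnramifiedAt_of_localLine
    (exists_tateLine_adicCompletionPrime V p TateCurve.Silverman1994_thmV53_tateUniformisation_holds
      TateCurve.Silverman1994_thmV53_corV54_tateUniformisation_holds hp2 hmult)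

omit [V.IsElliptic] [V.IsGloballyMinimal] in
/-- A curve all of whose rational `p`-lines are unramified is OFF the locus of the barrier
`EisensteinMuBarrier` (no rational `p`-line that is ramified at `p` and odd).
[cite: GreenbergLNM1716, Prop. 5.7 (p. 113)] -/
theorem not_hasRamifiedOddLineAt_of_forall_lineUnramifiedAt
    (h : ∀ Φ : AddSubgroup (geomTorsion V (p : ℤ)), IsRationalLine V p Φ → LineUnramifiedAt V p Φ) :
    ¬ HasRamifiedOddLineAt V p := by
  rintro ⟨Φ, hΦ, hram, -⟩
  exact hram (h Φ hΦ)

end Reduction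

/-! ## §4 The registered stub `stub_locate` of line `mudescent` on crux 5 -/

/-- **`stub_locate` (line `mudescent`, crux `MazurMCOnX1RankZero`, stmt-BirchSwinnertonDyer-19035) —
DESCEND: every rank-`0` X1 pair is `ℚ`-isogenous to one OFF the `μ`-barrier locus.** For `W` globally
minimal elliptic with `ClassX1 W p` (`2 < p`, `E[p]` reducible, good reduction, anomalous, type A) and
`ord_{s=1} L(E,s) = 0`: there is a globally minimal elliptic `W₀` with `IsIsogenous W W₀` and
`¬ HasRamifiedOddLineAt W₀ p`. By `exists_isIsogenous_forall_lineUnramifiedAt_of_good` (the class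
clause gives `2 < p`, `good(p)`, `red(p)`; the rank and the anomaly are not used). Exactly the
registered signature. [cite: GreenbergLNM1716, Conj. 1.11 (p. 58) and Prop. 5.7 (p. 113)]
[cite: Stevens1989, Cor. 4.13 and Rem. 4.14 (p. 94–95)] -/
theorem stub_locate :
    ∀ (W : WeierstrassCurve ℚ) [W.IsElliptic] [W.IsGloballyMinimal] (p : ℕ) [Fact p.Prime],
      ClassX1 W p → W.analyticRank = 0 →
        ∃ (W₀ : WeierstrassCurve ℚ) (_ : W₀.IsElliptic) (_ : W₀.IsGloballyMinimal),
          IsIsogenous W W₀ ∧ ¬ HasRamifiedOddLineAt W₀ p := by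
  intro W _ _ p _ hX1 _
  obtain ⟨W₀, hW₀, hmin, hiso, hunr⟩ :=
    exists_isIsogenous_forall_lineUnramifiedAt_of_good (V := W) hX1.1 hX1.2.2.1 hX1.2.1
  exact ⟨W₀, hW₀, hmin, hiso, not_hasRamifiedOddLineAt_of_forall_lineUnramifiedAt hunr⟩

end Summit.BirchSwinnertonDyer.BirchSwinnertonDyer.Theorems.EisensteinPrimesMazurMCOnX1RankZeroLocate

end
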